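import Summits.QuantumFields.GaugeBoot.Rows.GLYZc2D3HTab
import HarnessLib

/-!
# Gauge-boot: kernel check of the raw `H` class table, rows 0–37 (part 1/3)

Cell `pub-gaugeboot` (HOME `run/shared/lean/pub/pub-gaugeboot/`), seat lean1 (binding layer for rows C32–C33, C51–C60 = the certified
glyz-c2-rp-3D windows: label sets, class/witness tables, the reduction identity, soundness, per-β bindings).

HONEST FRAMING (page 1 of every file of this cell): certified bounds on lattice expectations at STATED coupling,
gauge group, dimension and torus size; NOT a mass gap, NOT a continuum limit, NOT a string tension, NOT large `N`.
The venture is explicitly NOT Yang–Mills-summit-bearing (barriers `FixedCouplingUltralocality`,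
`PerturbativeInvisibility`).

`hcanon_rows_<lo>_<hi> : ∀ i, lo ≤ i < hi → ∀ j ≥ i, HCanonOK i j`, each range one closed computation (`decide +kernel`);
assembled in `GLYZc2D3Canon`.
-/

noncomputable section

open Literature.MathematicalPhysics.QuantumFieldTheory

namespace Summit.QuantumFields.GaugeBoot

namespace GLYZc2D3

set_option maxHeartbeats 0 in
/-- Rows `0 ≤ i < 7` of the `H` class table canonicalise (1246 entries; closed computation checked by the kernel). -/
theorem hcanon_rows_0_7 : ∀ i : Fin 181, 0 ≤ i.val → i.val < 7 → ∀ j : Fin 181, i.val ≤ j.val → HCanonOK i j := by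
  decide +kernel

set_option maxHeartbeats 0 in
/-- Rows `7 ≤ i < 14` of the `H` class table canonicalise (1197 entries; closed computation checked by the kernel). -/
theorem hcanon_rows_7_14 : ∀ i : Fin 181, 7 ≤ i.val → i.val < 14 → ∀ j : Fin 181, i.val ≤ j.val → HCanonOK i j := by
  decide +kernel

set_option maxHeartbeats 0 in
/-- Rows `14 ≤ i < 22` of the `H` class table canonicalise (1308 entries; closed computation checked by the kernel). -/
theorem hcanon_rows_14_22 : ∀ i : Fin 181, 14 ≤ i.val → i.val < 22 → ∀ j : Fin 181, i.val ≤ j.val → HCanonOK i j := by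
  decide +kernel

set_option maxHeartbeats 0 in
/-- Rows `22 ≤ i < 30` of the `H` class table canonicalise (1244 entries; closed computation checked by the kernel). -/
theorem hcanon_rows_22_30 : ∀ i : Fin 181, 22 ≤ i.val → i.val < 30 → ∀ j : Fin 181, i.val ≤ j.val → HCanonOK i j := by
  decide +kernel

set_option maxHeartbeats 0 in
/-- Rows `30 ≤ i < 38` of the `H` class table canonicalise (1180 entries; closed computation checked by the kernel). -/
theorem hcanon_rows_30_38 : ∀ i : Fin 181, 30 ≤ i.val → i.val < 38 → ∀ j : Fin 181, i.val ≤ j.val → HCanonOK i j := by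
  decide +kernel

end GLYZc2D3

end Summit.QuantumFields.GaugeBoot

end
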